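import Literature.NumberTheory.EllipticCurves.ZpExtensionEisensteinH2TowerProofs
import Summits.BirchSwinnertonDyer.BirchSwinnertonDyer.Theorems.PrintX9MuPartHowardH2OfPrint
import HarnessLib

/-!
# Howard's H.2 (`H2Tower`) for the Eisenstein tower of `E_K` on the frames of the shared μ-crux — UNCONDITIONAL

Cell `pub/bsd-print-x9`, width seat `bsd-line-x10b-p1-w7` (g0) under LEAD `bsd-line-x10b-p1`; `--supports` the shared
μ-crux stmt-BirchSwinnertonDyer-22642 (`MuInequalityCoherentPair`, skeleton v3 STUB A `stub_howardInputs`: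
«`(hy : St.SatisfiesH)`», field `h2`).  THEOREMS ONLY; nothing here asserts the μ-item.  No summit statement is proved;
BSD is not proved by any of this.

`WeierstrassCurve.eisensteinTower_unitTwist_h2Tower` (Literature, `ZpExtensionEisensteinH2TowerProofs`: Howard's H.2 for
`T^{(k)} = E_K[p^{k+1}] ⊗ A_{m,k+1}(ψ)` from ONE homothety `z ≡ a` on `E_K[p]`, `p ∤ a − 1`, an anticyclotomic `κ`, an
imaginary quadratic `K` and a transported complex conjugation `cd.τ`) with the homothety DISCHARGED on the frames of the
letter by `HeegnerMuPartHowardH2.exists_smul_eq_zsmul_of_thm413Hypotheses` (p635540: `Thm413Hypotheses` + `(irr_ℚ)`,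
every odd `p`): **`eisensteinTower_h2Tower_of_thm413Hypotheses`** — the `h2` input of
`WeierstrassCurve.eisensteinDVRSettingTame_satisfiesH_of` for the tower at any unit twist `κ.unitTwist u` (the crux's
`κ⁻ = κ.unitTwist (-1)`), with the SAME `hc₀`/`hτ` hypotheses as its `h5a`.

References: B. Howard, Compositio Math. 140 (2004), §1.3 H.2 (arXiv:1202.6340 p. 7, L61–63), Lemma 2.6.2;
Castella–Grossi–Lee–Skinner, Invent. Math. 227 (2022), §3.2 (standing hypotheses); Lawson–Wuthrich (2016), Lemma 3–4.
-/

set_option autoImplicit false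
-- the summit and its single problem are both named `BirchSwinnertonDyer` (registry layout D-0017)
set_option linter.dupNamespace false

noncomputable section

open Function NumberField Field
open Literature.NumberTheory.EllipticCurves Literature.NumberTheory.GaloisRepresentations
open Literature.NumberTheory.GaloisCohomology.Howard2004

namespace Summit.BirchSwinnertonDyer.BirchSwinnertonDyer.Theorems.HeegnerMuPartHowardH2

variable {N : ℕ} {W : WeierstrassCurve ℚ} [W.IsGloballyMinimal] {K : Type} [Field K] [NumberField K]
  {p : ℕ} [Fact p.Prime] {κ : ZpExtension K p} {γ : absoluteGaloisGroup K}

/-- **Howard's H.2 (`AdicTower.H2Tower`) for the Eisenstein tower of `E_K` at any unit twist of the letter's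
anticyclotomic `κ` — unconditional on the frames of the shared μ-crux** (`Thm413Hypotheses N W K p κ γ` + `(irr_ℚ)`),
for a conjugation datum whose `τ` is the transported complex conjugation `c₀` (as in `eisensteinDVRSetting_h5a`): the
`h2` slot of `WeierstrassCurve.eisensteinDVRSettingTame_satisfiesH_of`. [cite: Howard2004HeegnerKolyvagin, §1.3 H.2 (arXiv p. 7, L61–63) and Lemma 2.6.2]
[cite: CastellaGrossiLeeSkinner2022, §3.2 standing hypotheses] -/
theorem eisensteinTower_h2Tower_of_thm413Hypotheses
    (hyp : CastellaGrossiLeeSkinner2022.Thm413Hypotheses N W K p κ γ) (hirr : W.HasIrreducibleModPGaloisRep p)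
    {m : ℕ} (hm : 1 ≤ m) (u : ℤ_[p]ˣ) (cd : ConjugationDatum K)
    {c₀ : absoluteGaloisGroup ℚ} (hc₀ : IsComplexConjugation (Rat.castHom ℝ) c₀)
    (hτ : ∀ x, cd.τ x = absGaloisTransport (K := ℚ) (L := K) c₀ x) :
    haveI := hyp.isElliptic
    letI := IwasawaAlgebra.isLocalRing_quotient_X_pow_add_C p hm
    (W.eisensteinTower (κ.unitTwist u) hm).H2Tower p cd ((W.baseChange K).torsionGaloisModule (p : ℤ)) := by
  haveI := hyp.isElliptic
  obtain ⟨z, a, ha, hz⟩ := exists_smul_eq_zsmul_of_thm413Hypotheses hyp hirr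
  exact W.eisensteinTower_unitTwist_h2Tower κ hm cd u hyp.isImaginaryQuadratic hyp.anticyclotomic hc₀ hτ hz ha

end Summit.BirchSwinnertonDyer.BirchSwinnertonDyer.Theorems.HeegnerMuPartHowardH2

end
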